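import Summits.QuantumFields.YangMills.Theorems.DirichletWindowAllSidesChessboardOddTorusFamilies
import HarnessLib

/-!
# The chessboard estimate for plaquette sets of ALL orientations on the odd torus — Schwarz step and estimate

Support file for item stmt-QuantumFields-20194 (`DirichletWindow.AllSidesCouplingChessboard`, K1 of the large-field
sparsity line; seat ym-dw-p1 g3).  Part 2 of 2; part 1 (`…OddTorusFamilies`) has the dictionary families ↦ plaquette
sets and the functional `Ψ`.

The tree's odd-torus chessboard `OddTorusChessboard.wilsonExpectation_expObs_le_rpow_orient` bounds the Chebyshev
functional `⟨exp(c ∑_{q ∈ P} φ_q)⟩_{Λ,β}` (`φ_q = N - Re tr ρ U_q`, `0 ≤ c ≤ β`, `L` odd, `L ≥ 3`) for plaquette sets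
`P` of ONE orientation.  Mixed orientations cannot be reached from it by Hölder's inequality over the `d(d-1)/2`
orientations (the coupling constraint `c ≤ β` caps the Hölder exponent).  Here the estimate is proved for an
ARBITRARY finite set of plaquettes,

  `⟨exp(c ∑_{q ∈ P} φ_q)⟩_{Λ,β} ≤ ⟨exp(c ∑_{all q} φ_q)⟩_{Λ,β} ^ (#P / L^d)`
  (`wilsonExpectation_expObs_le_rpow_all_odd`),

by the TWISTED two-class maximisation argument `AllSidesChessboard.twisted_chessboard_le_rpow_odd`: a plaquette set is
a family `A = (A_o)_o` of block patterns, one per orientation (dictionary `toPlaq o`, in-plane rows shifted by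
`S+1`), and the single weighted Osterwalder–Seiler Cauchy–Schwarz inequality of the axis `k`
(`sq_wilsonExpectation_mul_timeReflect_mul_expObs_le`, cut AND shared plaquettes weighted at once) symmetrises the
orientations transverse to `k` in the closed positive half-line (`csymP k`) and the orientations containing `k` in
the closed negative one (`symM k 1`) — the twisted inequality `mpsi_sq_le`.  Exponent: `#P / L^d` with `L^d` the
number of plaquettes of ONE orientation, as in the one-orientation estimate.

HONEST FRAMING: finite-torus reflection-positivity bookkeeping over tree theorems; nothing here is a statement about
the Yang–Mills mass gap or about infinite volume.  References: Fröhlich–Israel–Lieb–Simon, CMP 62 (1978) Thm. 4.1;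
Fröhlich–Lieb, CMP 60 (1978) Thm. 2.2/2.3; Osterwalder–Seiler, Ann. Phys. 110 (1978) §2; Seiler LNP 159 Ch. 2.
-/

noncomputable section

open MeasureTheory Finset
open Literature.MathematicalPhysics.QuantumFieldTheory
open Literature.MathematicalPhysics.QuantumFieldTheory.WilsonRP
open Literature.MathematicalPhysics.QuantumFieldTheory.WilsonOddRP
open Literature.Barriers.CriticalPhenomena.NonGibbs
open Literature.Probability.LatticeModels
open Summit.QuantumFields.YangMills.Theorems.SoloBlind
open Summit.QuantumFields.YangMills.Theorems.OddTorusChessboard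

namespace Summit.QuantumFields.YangMills.Theorems.AllSidesChessboard

variable {d L N : ℕ} [NeZero d] [NeZero L] {G : Type*} [Group G] [TopologicalSpace G]
  [IsTopologicalGroup G] [CompactSpace G] [MeasurableSpace G] [BorelSpace G]
  (ρ : G →* Matrix (Fin N) (Fin N) ℂ)

/-! ### §3. The core Cauchy–Schwarz step for families -/

section Core

variable [Fact (1 < L)]

/-- **Core step for families.**  For componentwise disjoint families `X` (positive plaquettes), `F` (cut or shared
plaquettes) and `Y` (whose reflections are positive): `Ψ(X ∪ F ∪ Y)² ≤ Ψ(X ∪ F ∪ θX) · Ψ(θY ∪ F ∪ Y)`. -/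
theorem mpsi_sq_le_core (hL : Odd L) (hL3 : 3 ≤ L) (hρ : Continuous ρ) {β c : ℝ} (hc : 0 ≤ c) (hcβ : c ≤ β)
    {X F Y : Orient d → Finset (BlockIdx d L)}
    (hXF : ∀ o, Disjoint (X o) (F o)) (hXFY : ∀ o, Disjoint (X o ∪ F o) (Y o))
    (hXFθ : ∀ o, Disjoint (X o ∪ F o) ((X o).image (cellReflect 0 1)))
    (hθFY : ∀ o, Disjoint ((Y o).image (cellReflect 0 1) ∪ F o) (Y o))
    (hθF : ∀ o, Disjoint ((Y o).image (cellReflect 0 1)) (F o))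
    (hX : ∀ o, ∀ x ∈ X o, IsOPosPlaq (toPlaq o x)) (hY : ∀ o, ∀ y ∈ Y o, IsOPosPlaq (toPlaq o (cellReflect 0 1 y)))
    (hF : ∀ o, ∀ f ∈ F o, IsOCrossPlaq (toPlaq o f) ∨ IsOSharedPlaq (toPlaq o f)) :
    mpsi (G := G) ρ β c (fun o => X o ∪ F o ∪ Y o) ^ 2 ≤
      mpsi ρ β c (fun o => X o ∪ F o ∪ (X o).image (cellReflect 0 1)) *
        mpsi ρ β c (fun o => (Y o).image (cellReflect 0 1) ∪ F o ∪ Y o) := by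
  -- the three plaquette sets
  set PX : Finset (Plaquette d L) := plaqs X with hPX
  set PF : Finset (Plaquette d L) := plaqs F with hPF
  set PY : Finset (Plaquette d L) := plaqs Y with hPY
  set PθX : Finset (Plaquette d L) := plaqs (fun o => (X o).image (cellReflect 0 1)) with hPθX
  set PθY : Finset (Plaquette d L) := plaqs (fun o => (Y o).image (cellReflect 0 1)) with hPθY
  have hθX : PθX = PX.image plaqReflect := plaqs_reflect hL X
  have hθY : PθY = PY.image plaqReflect := plaqs_reflect hL Y
  have hXpos : ∀ q ∈ PX, IsOPosPlaq q := by
    intro q hq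
    obtain ⟨b, hb, hbq⟩ := mem_plaqs.1 hq
    rw [← hbq]
    exact hX _ b hb
  have hθYpos : ∀ q ∈ PθY, IsOPosPlaq q := by
    intro q hq
    obtain ⟨b, hb, hbq⟩ := mem_plaqs.1 hq
    obtain ⟨y, hy, rfl⟩ := mem_image.1 hb
    rw [← hbq]
    exact hY _ y hy
  have hFcs : ∀ q ∈ PF, IsOCrossPlaq q ∨ IsOSharedPlaq q := by
    intro q hq
    obtain ⟨b, hb, hbq⟩ := mem_plaqs.1 hq
    rw [← hbq]
    exact hF _ b hb
  -- disjointness at the plaquette level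
  have dXF : Disjoint PX PF := disjoint_plaqs hXF
  have dXFY : Disjoint (PX ∪ PF) PY := by rw [hPX, hPF, ← plaqs_union]; exact disjoint_plaqs hXFY
  have dXFθ : Disjoint (PX ∪ PF) PθX := by rw [hPX, hPF, ← plaqs_union]; exact disjoint_plaqs hXFθ
  have dθFY : Disjoint (PθY ∪ PF) PY := by rw [hPθY, hPF, ← plaqs_union]; exact disjoint_plaqs hθFY
  have dθF : Disjoint PθY PF := disjoint_plaqs hθF
  -- the observables
  set Fo : GaugeConfig d L G → ℝ := expObs ρ c PX with hFo
  set Go : GaugeConfig d L G → ℝ := expObs ρ c PθY with hGo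
  obtain ⟨F₀, hFb⟩ := exists_abs_expObs_le (G := G) ρ hρ c PX
  obtain ⟨G₀, hGb⟩ := exists_abs_expObs_le (G := G) ρ hρ c PθY
  have key := sq_wilsonExpectation_mul_timeReflect_mul_expObs_le ρ hL hL3 hρ hc hcβ
    (measurable_expObs ρ hρ c _) hFb (dependsOn_expObs_of_pos ρ hL c hXpos)
    (measurable_expObs ρ hρ c _) hGb (dependsOn_expObs_of_pos ρ hL c hθYpos) PF hFcs
  have hθθY : PθY.image plaqReflect = PY := by
    rw [hθY, Finset.image_image]
    convert Finset.image_id (s := PY) using 2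
    funext q; exact plaqReflect_plaqReflect q
  have hGoΘ : ∀ U : GaugeConfig d L G, Go U.timeReflect = expObs ρ c PY U := by
    intro U; rw [hGo, expObs_timeReflect ρ hρ, hθθY]
  have hFoΘ : ∀ U : GaugeConfig d L G, Fo U.timeReflect = expObs ρ c PθX U := by
    intro U; rw [hFo, expObs_timeReflect ρ hρ, hθX]
  have e1 : (wilsonExpectation ρ β fun U : GaugeConfig d L G => Fo U * Go U.timeReflect * expObs ρ c PF U) =
      mpsi ρ β c (fun o => X o ∪ F o ∪ Y o) := by
    unfold mpsi
    congr 1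
    funext U
    rw [plaqs_union₃, ← hPX, ← hPF, ← hPY, ← expObs_mul_of_disjoint ρ c dXFY, ← expObs_mul_of_disjoint ρ c dXF,
      hGoΘ, hFo]
    ring
  have e2 : (wilsonExpectation ρ β fun U : GaugeConfig d L G => Fo U * Fo U.timeReflect * expObs ρ c PF U) =
      mpsi ρ β c (fun o => X o ∪ F o ∪ (X o).image (cellReflect 0 1)) := by
    unfold mpsi
    congr 1
    funext U
    rw [plaqs_union₃, ← hPX, ← hPF, ← hPθX, ← expObs_mul_of_disjoint ρ c dXFθ,
      ← expObs_mul_of_disjoint ρ c dXF, hFoΘ, hFo]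
    ring
  have e3 : (wilsonExpectation ρ β fun U : GaugeConfig d L G => Go U * Go U.timeReflect * expObs ρ c PF U) =
      mpsi ρ β c (fun o => (Y o).image (cellReflect 0 1) ∪ F o ∪ Y o) := by
    unfold mpsi
    congr 1
    funext U
    rw [plaqs_union₃, ← hPθY, ← hPF, ← hPY, ← expObs_mul_of_disjoint ρ c dθFY,
      ← expObs_mul_of_disjoint ρ c dθF, hGoΘ, hGo]
    ring
  rw [e1, e2, e3] at key
  exact key

end Core

/-! ### §4. The twisted Schwarz inequality in the direction `0` and in every direction -/

section Schwarz

/-- **The twisted Schwarz inequality of `Ψ` in the direction `0`**: orientations containing the axis `0` are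
symmetrised in the closed negative half-line (`symM 0 1`: their positive plaquettes are the HIGH rows, the fixed row is
CUT), the transverse ones in the closed positive half-line (`csymP 0`: positive plaquettes are the LOW rows, the fixed
row is SHARED) — both at once by ONE weighted reflection Cauchy–Schwarz inequality. -/
theorem mpsi_sq_le_zero (hL : Odd L) (hL3 : 3 ≤ L) (hρ : Continuous ρ) {β c : ℝ} (hc : 0 ≤ c) (hcβ : c ≤ β)
    (A : Orient d → Finset (BlockIdx d L)) :
    mpsi (G := G) ρ β c A ^ 2 ≤
      mpsi ρ β c (fun o => if o.1.1 = 0 then symM 0 1 (A o) else csymP 0 (A o)) *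
        mpsi ρ β c (fun o => if o.1.1 = 0 then csymP 0 (A o) else symM 0 1 (A o)) := by
  haveI : Fact (1 < L) := ⟨by omega⟩
  have hL1 : 1 < L := by omega
  -- positive part `X`, fixed part `F`, reflected-positive part `Y`, orientation by orientation
  set X : Orient d → Finset (BlockIdx d L) := fun o => if o.1.1 = 0 then highRows (A o) else lowRows (A o) with hX
  set F : Orient d → Finset (BlockIdx d L) := fun o => fixRow (A o) with hF
  set Y : Orient d → Finset (BlockIdx d L) := fun o => if o.1.1 = 0 then lowRows (A o) else highRows (A o) with hY
  have rot : ∀ P Q R : Finset (BlockIdx d L), P ∪ Q ∪ R = R ∪ Q ∪ P := fun P Q R => by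
    ext x; simp only [Finset.mem_union]; tauto
  have hA : A = fun o => X o ∪ F o ∪ Y o := by
    funext o
    by_cases ho : o.1.1 = 0
    · simp only [hX, hF, hY, ho, ↓reduceIte]
      rw [rot, lowRows_union_fixRow_union_highRows hL]
    · simp only [hX, hF, hY, ho, ↓reduceIte]
      rw [lowRows_union_fixRow_union_highRows hL]
  have hP : (fun o => if o.1.1 = 0 then symM 0 1 (A o) else csymP 0 (A o)) =
      fun o => X o ∪ F o ∪ (X o).image (cellReflect 0 1) := by
    funext o
    by_cases ho : o.1.1 = 0
    · simp only [hX, hF, ho, ↓reduceIte]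
      rw [symM_zero_one_eq hL hL1]
    · simp only [hX, hF, ho, ↓reduceIte]
      rw [csymP_zero_eq hL hL1]
  have hM : (fun o => if o.1.1 = 0 then csymP 0 (A o) else symM 0 1 (A o)) =
      fun o => (Y o).image (cellReflect 0 1) ∪ F o ∪ Y o := by
    funext o
    by_cases ho : o.1.1 = 0
    · simp only [hY, hF, ho, ↓reduceIte]
      rw [csymP_zero_eq hL hL1, rot]
    · simp only [hY, hF, ho, ↓reduceIte]
      rw [symM_zero_one_eq hL hL1, rot]
  rw [hP, hM]
  conv_lhs => rw [hA]
  refine mpsi_sq_le_core ρ hL hL3 hρ hc hcβ ?_ ?_ ?_ ?_ ?_ ?_ ?_ ?_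
  · intro o
    obtain ⟨d1, d2, d3, d4, d5, d6, d7, d8, d9, d10⟩ := rows_disjoint (d := d) hL hL1 (A o)
    by_cases ho : o.1.1 = 0 <;> simp only [hX, hF, ho, ↓reduceIte]
    exacts [d6, d1]
  · intro o
    obtain ⟨d1, d2, d3, d4, d5, d6, d7, d8, d9, d10⟩ := rows_disjoint (d := d) hL hL1 (A o)
    by_cases ho : o.1.1 = 0 <;> simp only [hX, hF, hY, ho, ↓reduceIte]
    exacts [d7, d2]
  · intro o
    obtain ⟨d1, d2, d3, d4, d5, d6, d7, d8, d9, d10⟩ := rows_disjoint (d := d) hL hL1 (A o)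
    by_cases ho : o.1.1 = 0 <;> simp only [hX, hF, ho, ↓reduceIte]
    exacts [d8, d3]
  · intro o
    obtain ⟨d1, d2, d3, d4, d5, d6, d7, d8, d9, d10⟩ := rows_disjoint (d := d) hL hL1 (A o)
    by_cases ho : o.1.1 = 0 <;> simp only [hF, hY, ho, ↓reduceIte]
    exacts [d9, d4]
  · intro o
    obtain ⟨d1, d2, d3, d4, d5, d6, d7, d8, d9, d10⟩ := rows_disjoint (d := d) hL hL1 (A o)
    by_cases ho : o.1.1 = 0 <;> simp only [hF, hY, ho, ↓reduceIte]
    exacts [d10, d5]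
  · intro o x hx
    by_cases ho : o.1.1 = 0
    · simp only [hX, ho, ↓reduceIte] at hx
      exact (rows_inplane hL hL3 ho x).1 (mem_highRows.1 hx).2
    · simp only [hX, ho, ↓reduceIte] at hx
      exact (rows_transverse ho x).1 (mem_lowRows.1 hx).2
  · intro o y hy
    by_cases ho : o.1.1 = 0
    · simp only [hY, ho, ↓reduceIte] at hy
      exact (rows_inplane hL hL3 ho _).1 (high_of_low hL hL1 (mem_lowRows.1 hy).2)
    · simp only [hY, ho, ↓reduceIte] at hy
      exact (rows_transverse ho _).1 (low_of_high hL hL1 (mem_highRows.1 hy).2)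
  · intro o f hf
    by_cases ho : o.1.1 = 0
    · exact Or.inl ((rows_inplane hL hL3 ho f).2 (mem_fixRow.1 hf).2)
    · exact Or.inr ((rows_transverse ho f).2 (mem_fixRow.1 hf).2)

omit [NeZero L] in
/-- An orientation contains the axis `0` iff its smaller index is `0`. -/
theorem inPlane_zero_iff (o : Orient d) : InPlane o 0 ↔ o.1.1 = 0 := by
  constructor
  · rintro (h | h)
    · exact h
    · exact absurd (h ▸ o.2) (by simp)
  · exact fun h => Or.inl h

/-- **The twisted Schwarz inequality of `Ψ` in every axis `k`**, by conjugating the axis-`0` inequality of the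
axis-exchanged family with the exchange `0 ↔ k`. -/
theorem mpsi_sq_le (hL : Odd L) (hL3 : 3 ≤ L) (hρ : Continuous ρ) {β c : ℝ} (hc : 0 ≤ c) (hcβ : c ≤ β)
    (k : Fin d) (A : Orient d → Finset (BlockIdx d L)) :
    mpsi (G := G) ρ β c A ^ 2 ≤
      mpsi ρ β c (fun o => if InPlane o k then symM k 1 (A o) else csymP k (A o)) *
        mpsi ρ β c (fun o => if InPlane o k then csymP k (A o) else symM k 1 (A o)) := by
  haveI : Fact (1 < L) := ⟨by omega⟩
  set A' : Orient d → Finset (BlockIdx d L) := fun o => (A (oSwap (L := L) k o)).image (swapIdx k) with hA'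
  have h := mpsi_sq_le_zero ρ hL hL3 hρ hc hcβ A'
  have e0 : mpsi (G := G) ρ β c A' = mpsi ρ β c A := mpsi_swap ρ hρ β c k A
  have hcond : ∀ o : Orient d, (oSwap (L := L) k o).1.1 = 0 ↔ InPlane o k := by
    intro o
    rw [← inPlane_zero_iff, inPlane_oSwap, Equiv.swap_apply_left]
  have hcond' : ∀ o : Orient d, o.1.1 = 0 ↔ InPlane (oSwap (L := L) k o) k := by
    intro o
    rw [← hcond, oSwap_oSwap]
  have e1 : mpsi (G := G) ρ β c (fun o => if o.1.1 = 0 then symM 0 1 (A' o) else csymP 0 (A' o)) =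
      mpsi ρ β c (fun o => if InPlane o k then symM k 1 (A o) else csymP k (A o)) := by
    rw [← mpsi_swap ρ hρ β c k (fun o => if InPlane o k then symM k 1 (A o) else csymP k (A o))]
    congr 1
    funext o
    by_cases ho : o.1.1 = 0
    · rw [if_pos ho, if_pos ((hcond' o).1 ho), hA', image_swapIdx_symM]
    · rw [if_neg ho, if_neg (fun h => ho ((hcond' o).2 h)), hA', image_swapIdx_csymP]
  have e2 : mpsi (G := G) ρ β c (fun o => if o.1.1 = 0 then csymP 0 (A' o) else symM 0 1 (A' o)) =
      mpsi ρ β c (fun o => if InPlane o k then csymP k (A o) else symM k 1 (A o)) := by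
    rw [← mpsi_swap ρ hρ β c k (fun o => if InPlane o k then csymP k (A o) else symM k 1 (A o))]
    congr 1
    funext o
    by_cases ho : o.1.1 = 0
    · rw [if_pos ho, if_pos ((hcond' o).1 ho), hA', image_swapIdx_csymP]
    · rw [if_neg ho, if_neg (fun h => ho ((hcond' o).2 h)), hA', image_swapIdx_symM]
  rw [e0, e1, e2] at h
  exact h

end Schwarz

/-! ### §5. The chessboard estimate for arbitrary plaquette sets on the odd torus -/

section Main

/-- **`Ψ(A) ≤ Ψ(⊤) ^ (size A / L^d)`** — the twisted two-class chessboard estimate applied to `Ψ`. -/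
theorem mpsi_le_rpow (hL : Odd L) (hL3 : 3 ≤ L) (hρ : Continuous ρ) {β c : ℝ} (hc : 0 ≤ c) (hcβ : c ≤ β)
    (A : Orient d → Finset (BlockIdx d L)) :
    mpsi (G := G) ρ β c A ≤
      mpsi ρ β c (fun _ => (univ : Finset (BlockIdx d L))) ^ (((∑ o, #(A o) : ℕ) : ℝ) / (L : ℝ) ^ d) := by
  classical
  have h1 : 0 < mpsi (G := G) ρ β c (fun _ : Orient d => (univ : Finset (BlockIdx d L))) :=
    lt_of_lt_of_le one_pos (one_le_wilsonExpectation_expObs ρ hρ β hc _)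
  refine twisted_chessboard_le_rpow_odd (fun k o => decide (InPlane o k)) hL hL3
    (fun A => mpsi_nonneg ρ β c A) h1 (fun i a A => mpsi_translate ρ β c i a A) (fun i A => ?_) (fun T => ?_) A
  · have h := mpsi_sq_le ρ hL hL3 hρ hc hcβ i A
    simp only [decide_eq_true_eq]
    exact h
  · -- cylinders: `Ψ(cyl T) ≤ Ψ(⊤) ≤ Ψ(⊤) ^ #T` for `T ≠ ∅`, and `Ψ(∅) = 1` for `T = ∅`
    by_cases hT : T = ∅
    · subst hT
      haveI := isProbabilityMeasure_wilsonMeasure (d := d) (L := L) (G := G) ρ hρ β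
      have : plaqs (fun o : Orient d => if o ∈ (∅ : Finset (Orient d)) then (univ : Finset (BlockIdx d L)) else ∅) =
          ∅ := by
        ext q; simp [mem_plaqs]
      simp only [card_empty, pow_zero]
      unfold mpsi wilsonExpectation
      rw [this]
      simp [expObs]
    · have hle : mpsi (G := G) ρ β c (fun o => if o ∈ T then (univ : Finset (BlockIdx d L)) else ∅) ≤
          mpsi ρ β c (fun _ : Orient d => (univ : Finset (BlockIdx d L))) := by
        unfold mpsi
        refine wilsonExpectation_expObs_mono ρ hρ hc β ?_
        rw [plaqs_top]; exact subset_univ _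
      refine hle.trans ?_
      have h1' : 1 ≤ mpsi (G := G) ρ β c (fun _ : Orient d => (univ : Finset (BlockIdx d L))) :=
        one_le_wilsonExpectation_expObs ρ hρ β hc _
      calc mpsi (G := G) ρ β c (fun _ : Orient d => (univ : Finset (BlockIdx d L)))
          = mpsi ρ β c (fun _ : Orient d => (univ : Finset (BlockIdx d L))) ^ 1 := (pow_one _).symm
        _ ≤ mpsi ρ β c (fun _ : Orient d => (univ : Finset (BlockIdx d L))) ^ #T :=
            pow_le_pow_right₀ h1' (Nat.one_le_iff_ne_zero.2 fun h => hT (card_eq_zero.1 h))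

/-- **The chessboard estimate on the odd torus for an ARBITRARY finite set of plaquettes** (every orientation at
once): for `L` odd, `L ≥ 3`, continuous `ρ`, `0 ≤ c ≤ β` and `P ⊆` plaquettes of `(ℤ/L)^d`,
`⟨exp(c ∑_{q ∈ P} φ_q)⟩_{Λ,β} ≤ ⟨exp(c ∑_{all q} φ_q)⟩_{Λ,β} ^ (#P / L^d)`. -/
theorem wilsonExpectation_expObs_le_rpow_all_odd (hL : Odd L) (hL3 : 3 ≤ L) (hρ : Continuous ρ) {β c : ℝ}
    (hc : 0 ≤ c) (hcβ : c ≤ β) (P : Finset (Plaquette d L)) :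
    wilsonExpectation ρ β (expObs (G := G) ρ c P) ≤
      wilsonExpectation ρ β (expObs (G := G) ρ c (univ : Finset (Plaquette d L))) ^ ((#P : ℝ) / (L : ℝ) ^ d) := by
  obtain ⟨A, hA, hcard⟩ := exists_plaqs_eq P
  have h := mpsi_le_rpow ρ hL hL3 hρ hc hcβ A
  rw [mpsi, mpsi, hA, plaqs_top, hcard] at h
  exact h

/-- **Free-energy form**: `⟨exp(c ∑_{q ∈ P} φ_q)⟩_{Λ,β} ≤ exp((#P / L^d) · (log Z_Λ(β - c) - log Z_Λ(β)))` for an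
arbitrary finite set of plaquettes of the odd torus (`L` odd, `L ≥ 3`, `0 ≤ c ≤ β`). -/
theorem wilsonExpectation_expObs_le_exp_card_all_odd (hL : Odd L) (hL3 : 3 ≤ L) (hρ : Continuous ρ) {β c : ℝ}
    (hc : 0 ≤ c) (hcβ : c ≤ β) (P : Finset (Plaquette d L)) :
    wilsonExpectation ρ β (expObs (G := G) ρ c P) ≤
      Real.exp ((#P : ℝ) / (L : ℝ) ^ d *
        (Literature.MathematicalPhysics.QuantumLattice.torusLogPartition d ρ (β - c) L -
          Literature.MathematicalPhysics.QuantumLattice.torusLogPartition d ρ β L)) := by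
  have hρN : ∀ g : G, (ρ g).trace.re ≤ N := fun g => by
    have h := Literature.RepresentationTheory.CompactGroups.CompactGroup.abs_re_trace_le_card ρ hρ g
    simp only [Fintype.card_fin] at h
    exact (le_abs_self _).trans h
  have h1 := wilsonExpectation_expObs_le_rpow_all_odd ρ hL hL3 hρ hc hcβ P
  have h2 := wilsonExpectation_expObs_le_exp (d := d) (L := L) (G := G) ρ hρ hρN hc β
    (univ : Finset (Plaquette d L))
  have hr : (0 : ℝ) ≤ (#P : ℝ) / (L : ℝ) ^ d := by positivity
  calc wilsonExpectation ρ β (expObs (G := G) ρ c P)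
      ≤ wilsonExpectation ρ β (expObs (G := G) ρ c (univ : Finset (Plaquette d L))) ^ ((#P : ℝ) / (L : ℝ) ^ d) := h1
    _ ≤ Real.exp (Literature.MathematicalPhysics.QuantumLattice.torusLogPartition d ρ (β - c) L -
          Literature.MathematicalPhysics.QuantumLattice.torusLogPartition d ρ β L) ^ ((#P : ℝ) / (L : ℝ) ^ d) :=
        Real.rpow_le_rpow (wilsonExpectation_expObs_nonneg ρ β c _) h2 hr
    _ = _ := by rw [← Real.exp_mul, mul_comm]

end Main

end Summit.QuantumFields.YangMills.Theorems.AllSidesChessboard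

end
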